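import Literature.Analysis.Calculus.UnitIntervalParametricDeriv
import Mathlib.Analysis.Distribution.TemperateGrowth
import Mathlib.MeasureTheory.Integral.IntegralEqImproper
import Mathlib.Data.Nat.Choose.Sum
import HarnessLib

/-!
# Regularity of bounded solutions of the Gallay–Wayne cell-profile equation

The radial profile of the vorticity `w_∞` of Gallay–Wayne 2006, Prop. 3.1 is obtained (in the
variable `t = r²`) from a bounded continuous solution `E` of the Volterra-type fixed-point equation

  `E(t) = ⅛ ( t ∫₀¹ v² q(tv) dv + ∫ₜ^∞ q(u) du ),   q = h · (E − ½)`,        (⋆)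

(`t ∫₀¹ v² q(tv) dv = t⁻² ∫₀ᵗ u² q`; this is the Green's-function form of the ODE (3.6) of
loc. cit.) for a smooth, integrable weight `h` of temperate growth. This file proves, for ANY such
`h` and any bounded continuous solution `E` of (⋆):

* `hasDerivAt_integral_Ioi'`: `d/dt ∫ₜ^∞ q = −q(t)` (`q` continuous, integrable);
* `hasDerivAt_mul_integral_sq_mul_comp_mul`: `d/dt [t ∫₀¹ v² q(tv) dv] = q(t) − 2∫₀¹ v² q(tv) dv`;
* `hasDerivAt_of_cellFixedPoint`: **`E' = −¼ ∫₀¹ v² q(tv) dv`**;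
* `contDiff_of_cellFixedPoint`: **`E ∈ C^∞`** (bootstrap: `E ∈ Cⁿ ⇒ q ∈ Cⁿ ⇒ E' ∈ Cⁿ`);
* `hasTemperateGrowth_of_cellFixedPoint`: **`E` has temperate growth** (the same induction on
  the order, with `(d/dt)ⁿ ∫₀¹ v² q(tv) dv = ∫₀¹ v^{n+2} q⁽ⁿ⁾(tv) dv` and the Leibniz bound).

Everything is proved; no definitions, no named facts.

## References

* Th. Gallay, C. E. Wayne, *Existence and stability of asymmetric Burgers vortices*, J. Math.
  Fluid Mech. 9 (2007) = arXiv:math/0503353, §3, (3.4)–(3.9). [GallayWayne2006]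
-/

noncomputable section

open Set Filter MeasureTheory intervalIntegral Finset
open scoped Topology ContDiff

namespace Literature.Analysis.FluidPDE

/-! ### Two derivative computations -/

/-- **`d/dt ∫ₜ^∞ q = −q(t)`** for `q` continuous and integrable on `ℝ`. [folklore] -/
theorem hasDerivAt_integral_Ioi' {q : ℝ → ℝ} (hq : Continuous q) (hqi : Integrable q) (t : ℝ) :
    HasDerivAt (fun s => ∫ u in Ioi s, q u) (-q t) t := by
  have hrepr : ∀ s, ∫ u in Ioi s, q u =
      (∫ u, q u) - ((∫ u in Iic 0, q u) + ∫ u in (0 : ℝ)..s, q u) := by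
    intro s
    have h1 := intervalIntegral.integral_Iic_add_Ioi (hqi.integrableOn (s := Iic s))
      (hqi.integrableOn (s := Ioi s))
    have h2 := intervalIntegral.integral_Iic_sub_Iic (hqi.integrableOn (s := Iic 0))
      (hqi.integrableOn (s := Iic s))
    linarith
  have hfun : (fun s => ∫ u in Ioi s, q u) =
      fun s => (∫ u, q u) - ((∫ u in Iic 0, q u) + ∫ u in (0 : ℝ)..s, q u) := funext hrepr
  rw [hfun]
  have hprim : HasDerivAt (fun s => ∫ u in (0 : ℝ)..s, q u) (q t) t :=
    integral_hasDerivAt_right (hq.intervalIntegrable _ _) (hq.stronglyMeasurableAtFilter _ _)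
      hq.continuousAt
  have h := (hprim.const_add (∫ u in Iic 0, q u)).const_sub (∫ u, q u)
  simpa using h

/-- **`d/dt [t ∫₀¹ v² q(tv) dv] = q(t) − 2 ∫₀¹ v² q(tv) dv`** for continuous `q` (for `t ≠ 0` the
function is `t⁻² ∫₀ᵗ u² q`; at `t = 0` both sides are computed directly). [folklore] -/
theorem hasDerivAt_mul_integral_sq_mul_comp_mul {q : ℝ → ℝ} (hq : Continuous q) (t : ℝ) :
    HasDerivAt (fun s => s * ∫ v in (0 : ℝ)..1, v ^ 2 * q (s * v))
      (q t - 2 * ∫ v in (0 : ℝ)..1, v ^ 2 * q (t * v)) t := by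
  set A : ℝ → ℝ := fun s => ∫ v in (0 : ℝ)..1, v ^ 2 * q (s * v) with hA
  have hAc : Continuous A := Calculus.continuous_integral_pow_mul_comp_mul hq 2
  rcases eq_or_ne t 0 with rfl | ht
  · -- at `t = 0`: `A 0 = q 0 / 3` and `s A(s) = s A(0) + o(s)`
    have hA0 : A 0 = q 0 / 3 := by
      simp only [hA, zero_mul]
      rw [intervalIntegral.integral_mul_const, integral_pow]
      ring
    have hval : q 0 - 2 * A 0 = A 0 := by rw [hA0]; ring
    change HasDerivAt (fun s => s * A s) (q 0 - 2 * A 0) 0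
    rw [hval, hasDerivAt_iff_isLittleO]
    simp only [zero_mul, sub_zero, smul_eq_mul]
    have h1 : (fun s : ℝ => s * A s - s * A 0) = fun s => s * (A s - A 0) := by
      funext s; ring
    rw [h1]
    have h2 : (fun s : ℝ => A s - A 0) =o[𝓝 0] fun _ => (1 : ℝ) := by
      rw [Asymptotics.isLittleO_one_iff]
      have := (hAc.tendsto 0).sub_const (A 0)
      simpa using this
    have h3 := (Asymptotics.isBigO_refl (fun s : ℝ => s) (𝓝 0)).mul_isLittleO h2
    simpa using h3
  · -- at `t ≠ 0`: the function agrees with `s ↦ (s²)⁻¹ ∫₀ˢ u² q` near `t`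
    have hev : (fun s => s * A s) =ᶠ[𝓝 t] fun s => (s ^ 2)⁻¹ * ∫ u in (0 : ℝ)..s, u ^ 2 * q u := by
      filter_upwards [isOpen_ne.mem_nhds ht] with s hs
      exact Calculus.mul_integral_pow_mul_comp_mul hs 2
    have hI : HasDerivAt (fun s => ∫ u in (0 : ℝ)..s, u ^ 2 * q u) (t ^ 2 * q t) t :=
      integral_hasDerivAt_right
        ((by fun_prop : Continuous fun u : ℝ => u ^ 2 * q u).intervalIntegrable _ _)
        ((by fun_prop : Continuous fun u : ℝ => u ^ 2 * q u).stronglyMeasurableAtFilter _ _)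
        (by fun_prop : Continuous fun u : ℝ => u ^ 2 * q u).continuousAt
    have hinv : HasDerivAt (fun s : ℝ => (s ^ 2)⁻¹) (-(2 * t) / (t ^ 2) ^ 2) t := by
      refine ((hasDerivAt_pow 2 t).inv (pow_ne_zero 2 ht)).congr_deriv ?_
      norm_num
    have hprod := hinv.mul hI
    have hAt : A t = (t ^ 3)⁻¹ * ∫ u in (0 : ℝ)..t, u ^ 2 * q u := by
      have h := Calculus.mul_integral_pow_mul_comp_mul (g := q) ht 2
      change t * A t = _ at h
      field_simp at h ⊢
      linarith
    refine (hprod.congr_of_eventuallyEq hev).congr_deriv ?_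
    rw [show (∫ v in (0 : ℝ)..1, v ^ 2 * q (t * v)) = (t ^ 3)⁻¹ * ∫ u in (0 : ℝ)..t, u ^ 2 * q u
      from hAt]
    field_simp
    ring

/-! ### Solutions of the fixed-point equation -/

section FixedPoint

variable {h E : ℝ → ℝ} {B : ℝ}
  (hh : h.HasTemperateGrowth) (hhi : Integrable h) (hE : Continuous E) (hB : ∀ t, |E t| ≤ B)
  (hfix : ∀ t, E t = 1 / 8 * ((t * ∫ v in (0 : ℝ)..1, v ^ 2 * (h (t * v) * (E (t * v) - 1 / 2))) +
    ∫ u in Ioi t, h u * (E u - 1 / 2)))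

include hhi hE hB in
/-- `q = h(E − ½)` is integrable. [folklore] -/
theorem integrable_weight_mul_sub : Integrable fun u => h u * (E u - 1 / 2) := by
  refine hhi.mul_bdd (c := B + 1 / 2) (by fun_prop : Continuous fun u => E u - 1 / 2).aestronglyMeasurable
    (Eventually.of_forall fun u => ?_)
  rw [Real.norm_eq_abs]
  calc |E u - 1 / 2| ≤ |E u| + |(1 / 2 : ℝ)| := abs_sub _ _
    _ ≤ B + 1 / 2 := by rw [abs_of_pos (by norm_num : (0 : ℝ) < 1 / 2)]; linarith [hB u]

include hh hhi hE hB hfix in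
/-- **The derivative of a solution**: `E'(t) = −¼ ∫₀¹ v² q(tv) dv`, `q = h(E − ½)`. [folklore] -/
theorem hasDerivAt_of_cellFixedPoint (t : ℝ) :
    HasDerivAt E (-(1 / 4) * ∫ v in (0 : ℝ)..1, v ^ 2 * (h (t * v) * (E (t * v) - 1 / 2))) t := by
  have hhc : Continuous h := hh.1.continuous
  have hqc : Continuous fun u => h u * (E u - 1 / 2) := by fun_prop
  have h1 := hasDerivAt_mul_integral_sq_mul_comp_mul hqc t
  have h2 := hasDerivAt_integral_Ioi' hqc (integrable_weight_mul_sub hhi hE hB) t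
  have h3 : HasDerivAt (fun s =>
      1 / 8 * ((s * ∫ v in (0 : ℝ)..1, v ^ 2 * (h (s * v) * (E (s * v) - 1 / 2))) +
      ∫ u in Ioi s, h u * (E u - 1 / 2)))
      (1 / 8 * ((h t * (E t - 1 / 2) - 2 * ∫ v in (0 : ℝ)..1, v ^ 2 * (h (t * v) * (E (t * v) - 1 / 2))) +
        -(h t * (E t - 1 / 2)))) t :=
    (h1.fun_add h2).const_mul (1 / 8)
  have h4 : E =ᶠ[𝓝 t] fun s =>
      1 / 8 * ((s * ∫ v in (0 : ℝ)..1, v ^ 2 * (h (s * v) * (E (s * v) - 1 / 2))) +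
      ∫ u in Ioi s, h u * (E u - 1 / 2)) := Eventually.of_forall hfix
  exact (h3.congr_of_eventuallyEq h4).congr_deriv (by ring)

include hh hhi hE hB hfix in
/-- The derivative of a solution, as a function. [folklore] -/
theorem deriv_of_cellFixedPoint :
    deriv E = fun t => -(1 / 4) * ∫ v in (0 : ℝ)..1, v ^ 2 * (h (t * v) * (E (t * v) - 1 / 2)) :=
  funext fun t => (hasDerivAt_of_cellFixedPoint hh hhi hE hB hfix t).deriv

include hh hhi hE hB hfix in
/-- **Smoothness of bounded continuous solutions** (bootstrap on the order). [folklore] -/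
theorem contDiff_of_cellFixedPoint : ContDiff ℝ ∞ E := by
  suffices key : ∀ k : ℕ, ContDiff ℝ k E from contDiff_infty.2 key
  intro k
  induction k with
  | zero => exact contDiff_zero.2 hE
  | succ k ih =>
    have hq : ContDiff ℝ k fun u => h u * (E u - 1 / 2) :=
      (hh.1.of_le (by exact_mod_cast le_top)).mul (ih.sub contDiff_const)
    have hA : ContDiff ℝ k fun t => ∫ v in (0 : ℝ)..1, v ^ 2 * (h (t * v) * (E (t * v) - 1 / 2)) :=
      Calculus.contDiff_integral_pow_mul_comp_mul (g := fun u => h u * (E u - 1 / 2)) hq 2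
    have hd : ContDiff ℝ k (deriv E) := by
      rw [deriv_of_cellFixedPoint hh hhi hE hB hfix]
      exact contDiff_const.mul hA
    rw [show ((k + 1 : ℕ) : WithTop ℕ∞) = (k : WithTop ℕ∞) + 1 by push_cast; rfl,
      contDiff_succ_iff_deriv]
    exact ⟨fun t => (hasDerivAt_of_cellFixedPoint hh hhi hE hB hfix t).differentiableAt,
      fun h => absurd h (by simp), hd⟩

include hh hhi hE hB hfix in
/-- **Polynomial bounds for all derivatives of a solution** (induction on the order: the
`(n+1)`-st derivative is `−¼ ∫₀¹ v^{n+2} q⁽ⁿ⁾(tv) dv` and `q⁽ⁿ⁾ = (h(E − ½))⁽ⁿ⁾` is bounded by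
Leibniz from the lower derivatives of `E` and the temperate growth of `h`). [folklore] -/
theorem exists_abs_iteratedDeriv_le_of_cellFixedPoint (n : ℕ) :
    ∃ (k : ℕ) (C : ℝ), ∀ j ≤ n, ∀ t, |iteratedDeriv j E t| ≤ C * (1 + |t|) ^ k := by
  have hsm : ContDiff ℝ ∞ E := contDiff_of_cellFixedPoint hh hhi hE hB hfix
  have hgsm : ContDiff ℝ ∞ fun u => E u - 1 / 2 := hsm.sub contDiff_const
  have hqsm : ContDiff ℝ ∞ fun u => h u * (E u - 1 / 2) := hh.1.mul hgsm
  induction n with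
  | zero =>
    refine ⟨0, B, fun j hj t => ?_⟩
    obtain rfl : j = 0 := Nat.le_zero.1 hj
    simpa using hB t
  | succ n ih =>
    obtain ⟨k, C, hC⟩ := ih
    obtain ⟨kh, Ch, hCh0, hCh⟩ := hh.norm_iteratedFDeriv_le_uniform n
    -- bounds for the derivatives of `g = E - 1/2` up to order `n`
    have hB0 : 0 ≤ B := (abs_nonneg _).trans (hB 0)
    have hC0 : 0 ≤ C := by
      have := hC 0 (Nat.zero_le _) 0
      simp only [iteratedDeriv_zero, abs_zero, add_zero, one_pow, mul_one] at this
      exact (abs_nonneg _).trans this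
    have hpos : 0 ≤ 2 ^ n * Ch * (C + B + 1) := by positivity
    have hg : ∀ i ≤ n, ∀ x,
        ‖iteratedFDeriv ℝ i (fun u => E u - 1 / 2) x‖ ≤ (C + B + 1) * (1 + |x|) ^ k := by
      intro i hi x
      have h1 : 1 ≤ (1 + |x|) ^ k := one_le_pow₀ (by linarith [abs_nonneg x])
      rw [norm_iteratedFDeriv_eq_norm_iteratedDeriv, Real.norm_eq_abs]
      rcases Nat.eq_zero_or_pos i with rfl | hi0
      · rw [iteratedDeriv_zero]
        calc |E x - 1 / 2| ≤ |E x| + |(1 / 2 : ℝ)| := abs_sub _ _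
          _ ≤ B + 1 := by
              rw [abs_of_pos (by norm_num : (0 : ℝ) < 1 / 2)]
              linarith [hB x]
          _ ≤ (C + B + 1) * (1 + |x|) ^ k := by
              nlinarith [mul_le_mul_of_nonneg_left h1 (by linarith : 0 ≤ C + B + 1)]
      · have : (fun u => E u - 1 / 2) = fun u => (-(1 / 2 : ℝ)) + E u := by funext u; ring
        rw [this, iteratedDeriv_const_add hi0]
        calc |iteratedDeriv i E x| ≤ C * (1 + |x|) ^ k := hC i hi x
          _ ≤ (C + B + 1) * (1 + |x|) ^ k := by
              gcongr
              linarith [(abs_nonneg _).trans (hB 0)]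
    -- Leibniz bound for `q⁽ⁿ⁾`
    have hq : ∀ x, |iteratedDeriv n (fun u => h u * (E u - 1 / 2)) x| ≤
        2 ^ n * Ch * (C + B + 1) * (1 + |x|) ^ (kh + k) := by
      intro x
      rw [← Real.norm_eq_abs, ← norm_iteratedFDeriv_eq_norm_iteratedDeriv]
      refine (norm_iteratedFDeriv_mul_le hh.1 hgsm x (mod_cast le_top)).trans ?_
      have hterm : ∀ i ∈ range (n + 1), (n.choose i : ℝ) * ‖iteratedFDeriv ℝ i h x‖ *
          ‖iteratedFDeriv ℝ (n - i) (fun u => E u - 1 / 2) x‖ ≤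
          (n.choose i : ℝ) * (Ch * (C + B + 1) * (1 + |x|) ^ (kh + k)) := by
        intro i hi
        have hin : i ≤ n := Nat.lt_succ_iff.1 (mem_range.1 hi)
        have h1 := hCh i hin x
        rw [Real.norm_eq_abs] at h1
        have h2 := hg (n - i) (Nat.sub_le n i) x
        calc (n.choose i : ℝ) * ‖iteratedFDeriv ℝ i h x‖ *
              ‖iteratedFDeriv ℝ (n - i) (fun u => E u - 1 / 2) x‖
            ≤ (n.choose i : ℝ) * (Ch * (1 + |x|) ^ kh) * ((C + B + 1) * (1 + |x|) ^ k) := by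
              gcongr
          _ = (n.choose i : ℝ) * (Ch * (C + B + 1) * (1 + |x|) ^ (kh + k)) := by rw [pow_add]; ring
      refine (Finset.sum_le_sum hterm).trans ?_
      rw [← Finset.sum_mul]
      have hsum : (∑ i ∈ range (n + 1), (n.choose i : ℝ)) = 2 ^ n := by
        have := Nat.sum_range_choose n
        exact_mod_cast this
      rw [hsum]
      ring_nf
      rfl
    -- the new top-order bound
    refine ⟨kh + k, max C (1 / 4 * (2 ^ n * Ch * (C + B + 1))), fun j hj t => ?_⟩
    have h1t : 1 ≤ 1 + |t| := by linarith [abs_nonneg t]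
    rcases Nat.lt_or_eq_of_le hj with hlt | rfl
    · calc |iteratedDeriv j E t| ≤ C * (1 + |t|) ^ k := hC j (Nat.lt_succ_iff.1 hlt) t
        _ ≤ max C (1 / 4 * (2 ^ n * Ch * (C + B + 1))) * (1 + |t|) ^ (kh + k) := by
            gcongr
            · exact le_max_left _ _
            · exact Nat.le_add_left k kh
    · rw [iteratedDeriv_succ', deriv_of_cellFixedPoint hh hhi hE hB hfix,
        iteratedDeriv_const_mul _ (by
          exact ((Calculus.contDiff_integral_pow_mul_comp_mul (n := ⊤)
            (g := fun u => h u * (E u - 1 / 2)) hqsm 2).of_le (mod_cast le_top)).contDiffAt),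
        congrFun (Calculus.iteratedDeriv_integral_pow_mul_comp_mul hqsm n 2) t, abs_mul]
      have hint : |∫ v in (0 : ℝ)..1, v ^ (2 + n) *
          iteratedDeriv n (fun u => h u * (E u - 1 / 2)) (t * v)| ≤
          2 ^ n * Ch * (C + B + 1) * (1 + |t|) ^ (kh + k) := by
        refine Calculus.norm_integral_pow_mul_comp_mul_le
          (g := iteratedDeriv n (fun u => h u * (E u - 1 / 2))) (2 + n) fun v hv => ?_
        refine (hq (t * v)).trans ?_
        have htv : |t * v| ≤ |t| := by
          rw [abs_mul, abs_of_nonneg hv.1]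
          exact mul_le_of_le_one_right (abs_nonneg t) hv.2
        gcongr
      calc |(-(1 / 4) : ℝ)| * |∫ v in (0 : ℝ)..1, v ^ (2 + n) *
            iteratedDeriv n (fun u => h u * (E u - 1 / 2)) (t * v)|
          ≤ 1 / 4 * (2 ^ n * Ch * (C + B + 1) * (1 + |t|) ^ (kh + k)) := by
            rw [abs_neg, abs_of_pos (by norm_num : (0 : ℝ) < 1 / 4)]
            gcongr
        _ = 1 / 4 * (2 ^ n * Ch * (C + B + 1)) * (1 + |t|) ^ (kh + k) := by ring
        _ ≤ max C (1 / 4 * (2 ^ n * Ch * (C + B + 1))) * (1 + |t|) ^ (kh + k) := by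
            gcongr
            exact le_max_right _ _

include hh hhi hE hB hfix in
/-- **Bounded continuous solutions have temperate growth.** [folklore] -/
theorem hasTemperateGrowth_of_cellFixedPoint : E.HasTemperateGrowth := by
  refine ⟨contDiff_of_cellFixedPoint hh hhi hE hB hfix, fun n => ?_⟩
  obtain ⟨k, C, hC⟩ := exists_abs_iteratedDeriv_le_of_cellFixedPoint hh hhi hE hB hfix n
  refine ⟨k, C, fun t => ?_⟩
  rw [norm_iteratedFDeriv_eq_norm_iteratedDeriv, Real.norm_eq_abs, Real.norm_eq_abs]
  exact hC n le_rfl t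

end FixedPoint

end Literature.Analysis.FluidPDE
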